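import Literature.Geometry.Lorentzian.BlackHoles
import Literature.Geometry.Lorentzian.IPlusRegular
import HarnessLib

/-!
# Uniqueness of `I⁺`-regular stationary vacuum black holes (Chruściel–Costa 2008, Thm. 1.3)

`Literature.Geometry.Lorentzian.BlackHoles` records the black-hole uniqueness theorem **gr.S23**
as the statement schema `stationary_black_hole_uniqueness IsIPlusRegular` in its `I⁺`-regularity
hypothesis, because Chruściel–Costa's Definition 1.1 was not expressible when that file was
written ("Chruściel–Costa's Thm. 1.3 is this schema at the transcription of their Def. 1.1; that
instance is documented, not asserted"). The transcription now exists
(`StationaryAFBlackHole.IsIPlusRegular`, file `IPlusRegular.lean`), and this file vendors the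
instance as a named fact:

* `ChruscielCosta2008_uniqueness` — Chruściel–Costa, *On uniqueness of stationary vacuum black
  holes*, Astérisque 321 (2008) = arXiv:0806.0016, **Theorem 1.3**: "Let `(M, g)` be a stationary,
  asymptotically flat, `I⁺`-regular, vacuum, four-dimensional analytic space-time. If each
  component of the event horizon is mean non-degenerate, then `⟨⟨M_ext⟩⟩` is isometric to the
  domain of outer communications of one of the Weinstein solutions of Section 6.7. In particular,
  if `𝓔⁺` is connected and mean non-degenerate, then `⟨⟨M_ext⟩⟩` is isometric to the domain of
  outer communications of a Kerr space-time." We vendor the second ("in particular") assertion, as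
  the schema `stationary_black_hole_uniqueness` at `StationaryAFBlackHole.IsIPlusRegular`;
* `ChruscielCosta2008_uniqueness.apply`, its hypothesis form, and
  `chruscielCosta2008_uniqueness_iff` / `chruscielCosta2008_uniqueness_iff'`, the same statement
  as the instance of the Alexakis–Ionescu–Klainerman schema `AlexakisIonescuKlainermanRigidity` at
  the predicate "`I⁺`-regular, analytic, connected non-degenerate horizon"
  (`stationary_black_hole_uniqueness_iff`);
* the predicate `StationaryAFBlackHole.IsIPlusRegularNonDegenerate` ("`I⁺`-regular with connected,
  non-degenerate `𝓔⁺`" — the horizon hypotheses of Thm. 1.3 without analyticity; a definition),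
  the monotonicity of both schemas in their predicate (`AlexakisIonescuKlainermanRigidity.mono`,
  `stationary_black_hole_uniqueness.mono`), and `ChruscielCosta2008_uniqueness.of_nonanalytic`:
  the (open) non-analytic statement `AlexakisIonescuKlainermanRigidity
  StationaryAFBlackHole.IsIPlusRegularNonDegenerate` implies the vendored theorem.

## Faithfulness (hypothesis by hypothesis)

The schema quantifies over `𝓑 : StationaryAFBlackHole` — a `4`-dimensional spacetime with a
complete Killing field timelike on `M_ext = ⋃ₜ φₜ(Σ_ext)` for an asymptotically flat end `Σ_ext`
with decay `h - δ = O₂(r^{-α})`, `k = O₁(r^{-α-1})`, `α > 0` (**stationary, asymptotically flat**,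
Chruściel–Costa §2.1–2.2) — and asks `𝓑.IsIPlusRegular` (**`I⁺`-regular**, Def. 1.1),
`𝓑.IsAnalytic` (**analytic**; the given atlas is `C^ω` and `g` is analytic in it — at least as
strong as printed), `Ric(g) = 0` (**vacuum**), `IsConnected 𝓑.horizon` (**`𝓔⁺` connected**, in
particular non-empty) and `𝓑.IsNonDegenerateHorizon 𝓑.Mext`: a Killing field `K`, nowhere zero on
and tangent to `𝓔⁺`, with `∇_K K = κ K` on `𝓔⁺` for one constant `κ ≠ 0`. The last hypothesis
implies **mean non-degeneracy** of `𝓔⁺` as printed (§2.3.1, (2.10)): `g(K, K)` is constant along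
the flow of the Killing field `K`, while `∇_K K = κ K` gives `K(g(K,K)) = 2κ g(K,K)`, so `κ ≠ 0`
forces `g(K, K) = 0` on `𝓔⁺`, i.e. `K` is a null Killing field tangent to the generators with
constant surface gravity `κ ≠ 0`, whence `⟨κ⟩_S = κ ≠ 0` for every cross-section `S` ("if `X` is
[tangent to the horizon generators], and if the surface gravity `κ` of `X` is constant on `S`,
then `⟨κ⟩_S` equals `κ`", §2.3.1). Hence every hypothesis of the vendored statement implies the
corresponding printed one, and the vendored `Prop` is implied by Theorem 1.3 (a named fact may be
weaker, never stronger, than its source). The **conclusion** `IsIsometricToKerrExterior` — the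
d.o.c. `⟨⟨M_ext⟩⟩` (an open submanifold) is isometric to the ingoing Kerr–Schild exterior
`{r > r₊}` of a Kerr metric with `|a| < M` — is the tree's rendering of "isometric to the domain of
outer communications of a Kerr space-time" for a non-empty, connected, non-degenerate horizon
(the Kerr member is then a subextremal black hole: the harmonic-map data of §6 have one horizon
rod of positive length), as recorded at `StationaryAFBlackHole.IsIsometricToKerrExterior`.

The instance of `AlexakisIonescuKlainermanRigidity` at the bare predicate `IsIPlusRegular` (no
analyticity, but also no horizon hypotheses) is **not** vendored and must not be mistaken for
Chruściel–Costa's open Conjecture 1.2: its conclusion (a subextremal Kerr exterior, `0 < M`) fails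
for Minkowski space and for extremal Kerr, both `I⁺`-regular and vacuum. The open non-analytic
uniqueness problem in this vocabulary is `AlexakisIonescuKlainermanRigidity
StationaryAFBlackHole.IsIPlusRegularNonDegenerate` (Chruściel–Costa 2008, p. 4: "the hypotheses of
analyticity and non-degeneracy are highly unsatisfactory, and one believes that they are not
needed for the conclusion"); it is a statement for route files (no published theorem), not a
Literature fact, and only its *name-free* form appears here (as the hypothesis of
`ChruscielCosta2008_uniqueness.of_nonanalytic`).

## References

* P. T. Chruściel, J. L. Costa, *On uniqueness of stationary vacuum black holes*, Astérisque 321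
  (2008) 195–265, arXiv:0806.0016, Def. 1.1, Conj. 1.2, Thm. 1.3, §2.3.1 (key `ChruscielCosta2008`).
* S. Alexakis, A. D. Ionescu, S. Klainerman, Commun. Math. Phys. 299 (2010) 89–127,
  arXiv:0904.0982, Main Theorem (key `AlexakisIonescuKlainerman2009`).
-/

noncomputable section

open scoped Manifold ContDiff

universe u

namespace Literature.Geometry.Lorentzian

/-! ### The horizon hypotheses of Theorem 1.3; monotonicity of the schemas -/

namespace StationaryAFBlackHole

/-- The stationary AF black hole `𝓑` is **`I⁺`-regular with connected, non-degenerate future event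
horizon**: `𝓑.IsIPlusRegular` (Chruściel–Costa Def. 1.1), `𝓔⁺ = 𝓑.horizon` is connected (hence
non-empty), and `𝓔⁺` is a non-degenerate horizon (`Spacetime.IsNonDegenerateHorizon`: a Killing
field nowhere zero on and tangent to `𝓔⁺` with `∇_K K = κ K`, `κ ≠ 0`; under the standing
Levi-Civita hypothesis, over which it is quantified as in `stationary_black_hole_uniqueness_iff`).
These are the global and horizon hypotheses of Chruściel–Costa's Thm. 1.3 other than analyticity and
vacuum — a DEFINITION (predicate on `𝓑`, explicit binder), the argument at which the
Alexakis–Ionescu–Klainerman schema is the non-analytic uniqueness problem. Chruściel–Costa,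
Astérisque 321 (2008) = arXiv:0806.0016, Def. 1.1 and Thm. 1.3 (hypotheses). [cite: ChruscielCosta2008, Thm. 1.3 (hypotheses)] -/
def IsIPlusRegularNonDegenerate (𝓑 : StationaryAFBlackHole.{u}) : Prop :=
  𝓑.IsIPlusRegular ∧ IsConnected 𝓑.horizon ∧
    ∀ [𝓑.metric.HasLeviCivita], 𝓑.toSpacetime.IsNonDegenerateHorizon 𝓑.Mext

variable (𝓑 : StationaryAFBlackHole.{u})

/-- Unfolding lemma for `IsIPlusRegularNonDegenerate`. [folklore] -/
lemma isIPlusRegularNonDegenerate_iff : 𝓑.IsIPlusRegularNonDegenerate ↔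
    𝓑.IsIPlusRegular ∧ IsConnected 𝓑.horizon ∧
      ∀ [𝓑.metric.HasLeviCivita], 𝓑.toSpacetime.IsNonDegenerateHorizon 𝓑.Mext :=
  Iff.rfl

variable {𝓑}

/-- An `I⁺`-regular non-degenerate black hole is `I⁺`-regular. [folklore] -/
lemma IsIPlusRegularNonDegenerate.isIPlusRegular (h : 𝓑.IsIPlusRegularNonDegenerate) :
    𝓑.IsIPlusRegular :=
  h.1

/-- The horizon of an `I⁺`-regular non-degenerate black hole is connected. [folklore] -/
lemma IsIPlusRegularNonDegenerate.isConnected_horizon (h : 𝓑.IsIPlusRegularNonDegenerate) :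
    IsConnected 𝓑.horizon :=
  h.2.1

/-- The horizon of an `I⁺`-regular non-degenerate black hole is non-empty (it is connected). [folklore] -/
lemma IsIPlusRegularNonDegenerate.horizon_nonempty (h : 𝓑.IsIPlusRegularNonDegenerate) :
    𝓑.horizon.Nonempty :=
  h.2.1.nonempty

/-- The horizon of an `I⁺`-regular non-degenerate black hole is a non-degenerate horizon (under
the standing Levi-Civita hypothesis). [folklore] -/
lemma IsIPlusRegularNonDegenerate.isNonDegenerateHorizon [𝓑.metric.HasLeviCivita]
    (h : 𝓑.IsIPlusRegularNonDegenerate) : 𝓑.toSpacetime.IsNonDegenerateHorizon 𝓑.Mext :=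
  h.2.2

end StationaryAFBlackHole

/-- The Alexakis–Ionescu–Klainerman schema is **antitone in its hypothesis predicate**: if it holds
at `P` and `Q` implies `P` pointwise, it holds at `Q`. Tautological. [folklore] -/
theorem AlexakisIonescuKlainermanRigidity.mono {P Q : StationaryAFBlackHole.{u} → Prop}
    (hPQ : ∀ 𝓑, Q 𝓑 → P 𝓑) (h : AlexakisIonescuKlainermanRigidity P) :
    AlexakisIonescuKlainermanRigidity Q :=
  fun 𝓑 _ _ hF hP hres hQ hvac ↦ h 𝓑 hF hP hres (hPQ 𝓑 hQ) hvac

/-- The gr.S23 schema is **antitone in its `I⁺`-regularity predicate**: if it holds at `P` and `Q`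
implies `P` pointwise, it holds at `Q`. Tautological. [folklore] -/
theorem stationary_black_hole_uniqueness.mono {P Q : StationaryAFBlackHole.{u} → Prop}
    (hPQ : ∀ 𝓑, Q 𝓑 → P 𝓑) (h : stationary_black_hole_uniqueness P) :
    stationary_black_hole_uniqueness Q :=
  fun 𝓑 _ _ hF hP hres hQ hω hvac hconn hnd ↦ h 𝓑 hF hP hres (hPQ 𝓑 hQ) hω hvac hconn hnd

/-! ### Theorem 1.3 as a named fact -/

/-- **gr.S23 — Chruściel–Costa's uniqueness theorem for `I⁺`-regular black holes** (named fact):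
every stationary, asymptotically flat, `I⁺`-regular (`StationaryAFBlackHole.IsIPlusRegular`,
Chruściel–Costa Def. 1.1), analytic, vacuum, four-dimensional black-hole space-time whose future
event horizon `𝓔⁺` is connected and non-degenerate has domain of outer communications
`⟨⟨M_ext⟩⟩` isometric to a subextremal Kerr exterior — the statement schema
`stationary_black_hole_uniqueness` of `BlackHoles.lean` at the predicate `IsIPlusRegular`. Printed:
"Let `(M, g)` be a stationary, asymptotically flat, `I⁺`-regular, vacuum, four-dimensional
analytic space-time. … In particular, if `𝓔⁺` is connected and mean non-degenerate, then
`⟨⟨M_ext⟩⟩` is isometric to the domain of outer communications of a Kerr space-time." See the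
module docstring for the hypothesis-by-hypothesis comparison (the schema's `IsAnalytic` and
`IsNonDegenerateHorizon` are at least as strong as "analytic" and "mean non-degenerate").
Chruściel–Costa, Astérisque 321 (2008) = arXiv:0806.0016, Thm. 1.3. [cite: ChruscielCosta2008, Thm. 1.3] -/
def ChruscielCosta2008_uniqueness : Prop :=
  stationary_black_hole_uniqueness StationaryAFBlackHole.IsIPlusRegular.{u}

/-- Hypothesis form of Chruściel–Costa's Theorem 1.3: given the named fact, an `I⁺`-regular,
analytic, vacuum stationary AF black hole with connected non-degenerate horizon has d.o.c.
isometric to a subextremal Kerr exterior. Tautological unfolding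
(`stationary_black_hole_uniqueness.apply`). Chruściel–Costa 2008, Thm. 1.3. [cite: ChruscielCosta2008, Thm. 1.3] -/
theorem ChruscielCosta2008_uniqueness.apply (h : ChruscielCosta2008_uniqueness.{u})
    (𝓑 : StationaryAFBlackHole.{u}) [𝓑.metric.HasLeviCivita] [Kerr.Facts]
    (hF : 𝓑.metric.isOpen_chronologicalFuture 𝓑.timeOrientation)
    (hP : 𝓑.metric.isOpen_chronologicalPast 𝓑.timeOrientation)
    (hres : PseudoRiemannianMetric.contMDiff_restrict (I := 𝓡 4) (n := ∞) (M := 𝓑.carrier))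
    (hreg : 𝓑.IsIPlusRegular) (hω : 𝓑.IsAnalytic)
    (hvac : 𝓑.metric.toPseudoRiemannianMetric.IsRicciFlat) (hconn : IsConnected 𝓑.horizon)
    (hnd : 𝓑.toSpacetime.IsNonDegenerateHorizon 𝓑.Mext) :
    𝓑.IsIsometricToKerrExterior hF hP hres :=
  stationary_black_hole_uniqueness.apply h 𝓑 hF hP hres hreg hω hvac hconn hnd

/-- Chruściel–Costa's Theorem 1.3 is the instance of the Alexakis–Ionescu–Klainerman rigidity
schema at the predicate "`I⁺`-regular, analytic, with connected non-degenerate horizon"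
(`stationary_black_hole_uniqueness_iff` at `IsIPlusRegular`). Chruściel–Costa 2008, Thm. 1.3;
Alexakis–Ionescu–Klainerman 2010, Main Theorem (same conclusion, other hypotheses). [cite: ChruscielCosta2008, Thm. 1.3] -/
theorem chruscielCosta2008_uniqueness_iff : ChruscielCosta2008_uniqueness.{u} ↔
    AlexakisIonescuKlainermanRigidity.{u} fun 𝓑 ↦ 𝓑.IsIPlusRegular ∧ 𝓑.IsAnalytic ∧
      IsConnected 𝓑.horizon ∧
        ∀ [𝓑.metric.HasLeviCivita], 𝓑.toSpacetime.IsNonDegenerateHorizon 𝓑.Mext :=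
  stationary_black_hole_uniqueness_iff _


/-- Chruściel–Costa's Theorem 1.3 is the Alexakis–Ionescu–Klainerman schema at "analytic and
`IsIPlusRegularNonDegenerate`" (reassociation of `chruscielCosta2008_uniqueness_iff`).
Chruściel–Costa 2008, Thm. 1.3. [cite: ChruscielCosta2008, Thm. 1.3] -/
theorem chruscielCosta2008_uniqueness_iff' : ChruscielCosta2008_uniqueness.{u} ↔
    AlexakisIonescuKlainermanRigidity.{u} fun 𝓑 ↦
      𝓑.IsAnalytic ∧ 𝓑.IsIPlusRegularNonDegenerate := by
  rw [chruscielCosta2008_uniqueness_iff]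
  constructor
  · exact fun h ↦ h.mono fun 𝓑 h𝓑 ↦ ⟨h𝓑.2.1, h𝓑.1, h𝓑.2.2.1, fun {_} ↦ h𝓑.2.2.2⟩
  · exact fun h ↦ h.mono fun 𝓑 h𝓑 ↦ ⟨h𝓑.2.1, h𝓑.1, h𝓑.2.2.1, fun {_} ↦ h𝓑.2.2.2⟩

/-- **The non-analytic uniqueness statement implies Theorem 1.3**: if the Alexakis–Ionescu–Klainerman
schema holds at `IsIPlusRegularNonDegenerate` (uniqueness of smooth `I⁺`-regular vacuum black holes
with connected non-degenerate horizon — an open problem, Chruściel–Costa 2008, p. 4, and the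
instance of their Conjecture 1.2 with non-degenerate connected horizon; no published theorem, hence
only a hypothesis here), then the vendored analytic theorem follows (drop analyticity). Tautological.
Chruściel–Costa 2008, Thm. 1.3 and p. 4. [cite: ChruscielCosta2008, Thm. 1.3] -/
theorem ChruscielCosta2008_uniqueness.of_nonanalytic
    (h : AlexakisIonescuKlainermanRigidity StationaryAFBlackHole.IsIPlusRegularNonDegenerate.{u}) :
    ChruscielCosta2008_uniqueness.{u} :=
  chruscielCosta2008_uniqueness_iff'.2 (h.mono fun _ h𝓑 ↦ h𝓑.2)

end Literature.Geometry.Lorentzian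

end
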